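import Summits.BirchSwinnertonDyer.BirchSwinnertonDyer.Theses.GenusKolyvaginAtTwo
import Summits.BirchSwinnertonDyer.BirchSwinnertonDyer.Theses.ByReductionTypeAtTwo
import Summits.BirchSwinnertonDyer.Rank1Residual.GaloisImage.JWitnessTowerSurjectivity
import Literature.NumberTheory.EllipticCurves.TwoTorsionOddDegreeBaseChangeProofs
import HarnessLib

/-!
# Crux `MinimalTwinBSDTwo` (route `GenusKolyvaginAtTwo`, item stmt-BirchSwinnertonDyer-22985): PLACEMENT BRIDGES —
# crux #6 is implied BY NAME by the route's own residual (crux #5) and by the rank-one items of route `ByReductionTypeAtTwo`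

Cell `bsd-f1-sign2`, seat `bsd-line-gk2-p4` (prover seat 4, WIDTH-5 attach, on D-0145 line
`route-BirchSwinnertonDyer-GenusKolyvaginAtTwo`, OPEN rev 2). SUPPORT file for the crux
`Summit.BirchSwinnertonDyer.BirchSwinnertonDyer.Theses.GenusKolyvaginAtTwo.MinimalTwinBSDTwo`
(«BSD₂ for non-CM `W/ℚ` of analytic rank `1` with `#Sel₂(W) = 2`»; `--supports stmt-BirchSwinnertonDyer-22985`).
HONEST FRAMING: nothing here attacks the crux; BSD is not proved by any of this. What is recorded, kernel-checked, is
WHERE the crux sits among the tree's typed open statements at `p = 2`, so that the planners do not count the same open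
content twice (the sibling seat gk2-p2 isolated the crux's research content as the `2`-adic unit statement (U₂),
`Theorems/GenusKolyvaginAtTwoMinimalTwinBSDTwoStructure.lean`; the LEAD gk2-p1 placed stub A of crux #2 under the
`2`-converse crux 19220 the same way, `…GenusPrimitiveSupplyAtTwoTwinConverse.lean`).

## What is proved (sorry-free, no named fact)

* §1 `minimalTwinBSDTwo_of_offHabitatResidualAtTwo` — IN-ROUTE: crux #5 `OffHabitatResidualAtTwo` (the declared
  residual, item 22139) ⟹ crux #6 BY NAME. A curve of analytic rank `1` is off the habitat (whose first clause is
  `analyticRank = 0`), so the residual already asserts `BSDp W 2` for it; the `#Sel₂ = 2` binder is idle. (Observed by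
  refuter-parity-tllh-ref-1 in the item's check note, 2026-08-27T23:32Z, as an `example`; landed here.) So, as far as
  the ledger's logic goes, the deciding theorem `closes` could take `hTw := minimalTwinBSDTwo_of_offHabitatResidualAtTwo hR`:
  the typed crux is exactly the critic's price (1) — an honest, separately attackable name for the rank-one input —
  and carries no obligation beyond the residual's.
* §2 `minimalTwinBSDTwo_of_rankOneAtTwo` — CROSS-ROUTE: `Theses.ByReductionTypeAtTwo.RankOneAtTwo` (item 19099, the
  rank-one residual of route `ByReductionTypeAtTwo`: BSD₂ for every non-CM curve of analytic rank `1`) ⟹ crux #6 BY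
  NAME (drop the `#Sel₂` binder). Crux #6 is the `Ш[2] = 0`-slice of 19099.
* §3 `hasSurjectiveModNGaloisRep_one`, `forall_hasSurjectiveModNGaloisRep_two_pow_of_pos` — currency exchange between
  this route's big-image binder `∀ n > 0, ρ̄_{E,2^n}` onto (levels `(2 : ℤ) ^ n`) and the W-42 (β) binder of item 23715
  `∀ n, ρ̄_{E,2^n}` onto (levels `((2 ^ n : ℕ) : ℤ)`, `n = 0` included: `Aut(E[1])` is trivial).
* §4 `bsdp_two_of_rankOneAtTwoBigImageOddLocal` — CROSS-ROUTE, the W-42 (β) SLICE: item 23715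
  `Theses.ByReductionTypeAtTwo.RankOneAtTwoBigImageOddLocal` (the crux of the cell's `fkl` / `egg-kolyvagin-two` lines)
  gives `BSDp W 2` for every non-CM `W` of analytic rank `1` with `ρ̄_{W,2^n}` onto for all `n ≥ 1` and ODD Tamagawa
  product — the odd-torsion binder of 23715 is automatic (`ρ̄_{W,2}` onto ⟹ `W(ℚ)[2] = 0` ⟹ `#W(ℚ)_tors` odd,
  Dokchitser–Dokchitser / Cauchy, tree `odd_torsionOrder_of_hasSurjectiveModNGaloisRep_two`), and NO `2`-Selmer
  hypothesis is needed.
* §5 `bsdp_two_twin_of_rankOneAtTwoBigImageOddLocal` and `bsdp_two_heegnerTwin_of_rankOneAtTwoBigImageOddLocal` —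
  ON THE ROUTE'S OWN TWINS: for `E` (model `W`) with `ρ̄_{E,2^n}` onto for all `n ≥ 1` — the habitat's binder O1 — and
  ANY `ℚ`-model `Wd` of a quadratic twist `E^{(d)}` (`d ≠ 0`; in the route `d = d_K`), big `2`-adic image TRANSPORTS to
  the twin (Silverman AEC X.5 Cor. 5.4, `χ_d`-equivariance of the twisting isomorphism; tree theorem
  `hasSurjectiveModNGaloisRep_pow_iff_of_model_twist`, cell b2b-bsdres), so 23715 delivers `BSDp Wd 2` as soon as
  `r_an(Wd) = 1` and `∏_q c_q(Wd)` is ODD. READING for the planner: on the sub-habitat «odd Tamagawa product of the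
  minimal twin» the rank-one input `hTw` of `closes` is item 23715 (staffed, W-42 (β)); only the even-Tamagawa twins need
  crux #6 / 19099 proper. (The supply crux #2 does not promise odd `∏ c_q(Wd)`; whether the census twins of
  W52-HABITAT-ROW1-v1-ADDENDUM-1 have it is a data question, not asked here.)

References: Silverman, AEC 2nd ed. (2009) X.5 Cor. 5.4, VIII.7 [SilvermanAEC2009]; T. and V. Dokchitser, Math. Z. 272
(2012) [DokchitserDokchitserMathZ2012]; R. L. Miller, LMS J. Comput. Math. 14 (2011) Def. 1.1 [Miller2011LMS].
-/

set_option autoImplicit false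
set_option linter.dupNamespace false -- `Summit.BirchSwinnertonDyer.BirchSwinnertonDyer.…` is the tree's layout (D-0017)

noncomputable section

open scoped Classical

namespace Summit.BirchSwinnertonDyer.BirchSwinnertonDyer.Theorems.MinimalTwinBSDTwo

open WeierstrassCurve Literature.NumberTheory.EllipticCurves
open Summit.BirchSwinnertonDyer.BirchSwinnertonDyer.Theses

/-! ## §1 In-route: the declared residual implies the crux -/

/-- **Crux #5 ⟹ crux #6, by name.** `OffHabitatResidualAtTwo` asserts `BSDp W 2` for every non-CM `W` with
`r_an(W) ≤ 1` that is NOT on the habitat `(r_an = 0 ∧ big 2-adic image ∧ odd Tamagawa ∧ optimal with odd Manin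
constant)`; a curve with `r_an(W) = 1` fails the first clause, so the residual applies. The `#Sel₂(W) = 2` binder of the
crux is not used. [folklore] -/
theorem minimalTwinBSDTwo_of_offHabitatResidualAtTwo (hR : GenusKolyvaginAtTwo.OffHabitatResidualAtTwo) :
    GenusKolyvaginAtTwo.MinimalTwinBSDTwo := by
  intro W _ _ hcm har _hSel
  haveI : NeZero (W.conductorNorm ℤ) := ⟨(W.conductorNorm_pos_holds).ne'⟩
  refine hR W hcm (by rw [har]) ?_
  rintro ⟨h0, -⟩
  rw [har] at h0
  exact one_ne_zero h0

/-! ## §2 Cross-route: the rank-one residual of `ByReductionTypeAtTwo` implies the crux -/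

/-- **Item 19099 ⟹ crux #6, by name.** `RankOneAtTwo` (route `ByReductionTypeAtTwo`: BSD₂ for every non-CM
globally minimal `W/ℚ` of analytic rank `1`) implies `MinimalTwinBSDTwo` by dropping the `#Sel₂(W) = 2` binder: crux #6
is the `2`-Selmer-minimal (`Ш[2] = 0`, no rational `2`-torsion) slice of 19099. [folklore] -/
theorem minimalTwinBSDTwo_of_rankOneAtTwo (h : ByReductionTypeAtTwo.RankOneAtTwo) :
    GenusKolyvaginAtTwo.MinimalTwinBSDTwo :=
  fun W _ _ hcm har _ ↦ h W hcm har

/-! ## §3 Currency exchange for the big-image binder -/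

/-- **`ρ̄_{E,1}` is onto**: `E[1] = 0`, so `Aut(E[1])` is the trivial group and every element is the image of
`1 ∈ Γ_ℚ`. (The `n = 0` conjunct of item 23715's binder `∀ n, ρ̄_{E,2^n}` onto; pre-vet bsd-vet-tk5c.) [folklore] -/
theorem hasSurjectiveModNGaloisRep_one (W : WeierstrassCurve ℚ) : W.HasSurjectiveModNGaloisRep 1 := by
  haveI : Subsingleton (geomTorsion W (1 : ℤ)) := ⟨fun a b ↦ by
    have ha := AddSubgroup.torsionBy.nsmul_iff.mp a.2
    have hb := AddSubgroup.torsionBy.nsmul_iff.mp b.2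
    simp only [one_smul] at ha hb
    exact Subtype.ext (ha.trans hb.symm)⟩
  intro y
  exact ⟨1, Multiplicative.toAdd.injective (AddEquiv.ext fun a ↦ Subsingleton.elim _ _)⟩

/-- **This route's binder `∀ n > 0, ρ̄_{E,(2:ℤ)^n}` onto gives item 23715's binder `∀ n, ρ̄_{E,((2^n:ℕ):ℤ)}` onto**
(`n = 0` by `hasSurjectiveModNGaloisRep_one`, `n ≥ 1` by `Nat.cast_pow`). [folklore] -/
theorem forall_hasSurjectiveModNGaloisRep_two_pow_of_pos (W : WeierstrassCurve ℚ)
    (hρ : ∀ n : ℕ, 0 < n → W.HasSurjectiveModNGaloisRep ((2 : ℤ) ^ n)) :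
    ∀ n : ℕ, W.HasSurjectiveModNGaloisRep ((2 ^ n : ℕ) : ℤ) := by
  intro n
  rcases Nat.eq_zero_or_pos n with rfl | hn
  · simpa using hasSurjectiveModNGaloisRep_one W
  · have h := hρ n hn
    simpa [Nat.cast_pow] using h

/-- Conversely, item 23715's binder gives this route's. [folklore] -/
theorem forall_hasSurjectiveModNGaloisRep_two_pow_pos_of (W : WeierstrassCurve ℚ)
    (hρ : ∀ n : ℕ, W.HasSurjectiveModNGaloisRep ((2 ^ n : ℕ) : ℤ)) :
    ∀ n : ℕ, 0 < n → W.HasSurjectiveModNGaloisRep ((2 : ℤ) ^ n) := by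
  intro n _
  have h := hρ n
  simpa [Nat.cast_pow] using h

/-! ## §4 The W-42 (β) slice: item 23715 gives BSD₂ in analytic rank one under big image and odd Tamagawa product -/

/-- **Item 23715 ⟹ BSD₂ for non-CM `W` of analytic rank `1` with `ρ̄_{W,2^n}` onto (`n ≥ 1`) and odd `∏ c_q(W)`** —
no `2`-Selmer hypothesis. The odd-torsion binder of `RankOneAtTwoBigImageOddLocal` is discharged: `ρ̄_{W,2}` onto ⟹
no rational `2`-torsion ⟹ `#W(ℚ)_tors` odd (tree `odd_torsionOrder_of_hasSurjectiveModNGaloisRep_two`,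
Dokchitser–Dokchitser 2012 Thm (1) with Cauchy / Silverman VIII.7).
[cite: DokchitserDokchitserMathZ2012, Theorem (1)] [cite: SilvermanAEC2009, VIII.7] -/
theorem bsdp_two_of_rankOneAtTwoBigImageOddLocal (h : ByReductionTypeAtTwo.RankOneAtTwoBigImageOddLocal)
    (W : WeierstrassCurve ℚ) [W.IsElliptic] [W.IsGloballyMinimal] (hcm : ¬ W.HasCM)
    (hρ : ∀ n : ℕ, 0 < n → W.HasSurjectiveModNGaloisRep ((2 : ℤ) ^ n))
    (hT : Odd W.tamagawaProduct) (har : W.analyticRank = 1) : BSDp W 2 := by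
  have h2 : W.HasSurjectiveModNGaloisRep 2 := by simpa using hρ 1 one_pos
  exact h W hcm (forall_hasSurjectiveModNGaloisRep_two_pow_of_pos W hρ)
    (odd_torsionOrder_of_hasSurjectiveModNGaloisRep_two W h2) hT har

/-- **The `2`-Selmer-minimal form** (crux #6's binders plus big image and odd Tamagawa): item 23715 ⟹ `BSDp W 2` for
non-CM `W` with `r_an(W) = 1`, `#Sel₂(W) = 2`, `ρ̄_{W,2^n}` onto for `n ≥ 1`, `∏ c_q(W)` odd. (The `#Sel₂` binder is
idle; kept to display crux #6 restricted to the W-42 (β) slice.) [folklore] -/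
theorem minimalTwinBSDTwo_slice_of_rankOneAtTwoBigImageOddLocal
    (h : ByReductionTypeAtTwo.RankOneAtTwoBigImageOddLocal) :
    ∀ (W : WeierstrassCurve ℚ) [W.IsElliptic] [W.IsGloballyMinimal], ¬ W.HasCM → W.analyticRank = 1 →
      Nat.card (W.selmerGroup 2) = 2 → (∀ n : ℕ, 0 < n → W.HasSurjectiveModNGaloisRep ((2 : ℤ) ^ n)) →
      Odd W.tamagawaProduct → BSDp W 2 :=
  fun W _ _ hcm har _ hρ hT ↦ bsdp_two_of_rankOneAtTwoBigImageOddLocal h W hcm hρ hT har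

/-! ## §5 On the route's own twins: big `2`-adic image transports along the quadratic twist -/

/-- **Big `2`-adic image of `E` passes to every `ℚ`-model of every quadratic twist.** If `ρ̄_{E,2^n}` is onto for all
`n ≥ 1` and `C • E^{(d)} = Wd` over `ℚ` (`d ≠ 0`), then `ρ̄_{Wd,2^n}` is onto for all `n ≥ 1`: the twisting isomorphism
`E^{(d)}(ℚ̄) ≃ E(ℚ̄)` is `χ_d`-equivariant and `−1 ∈ Aut(E[2^n])` is a square of a Galois-commuting automorphism, so the
images agree up to the sign character and surjectivity is equivalent (Silverman AEC X.5 Cor. 5.4; tree theorem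
`Summit.BirchSwinnertonDyer.Rank1Residual.GaloisImage.hasSurjectiveModNGaloisRep_pow_iff_of_model_twist`).
[cite: SilvermanAEC2009, X.5 Cor. 5.4 and X.2 Prop. 2.4] -/
theorem forall_hasSurjectiveModNGaloisRep_two_pow_of_model_twist (W : WeierstrassCurve ℚ) [W.IsElliptic]
    (hρ : ∀ n : ℕ, 0 < n → W.HasSurjectiveModNGaloisRep ((2 : ℤ) ^ n)) {d : ℚ} (hd : d ≠ 0)
    {Wd : WeierstrassCurve ℚ} (hWd : ∃ C : VariableChange ℚ, C • W.quadraticTwist d = Wd) :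
    ∀ n : ℕ, 0 < n → Wd.HasSurjectiveModNGaloisRep ((2 : ℤ) ^ n) := by
  haveI : Fact (Nat.Prime 2) := ⟨Nat.prime_two⟩
  refine forall_hasSurjectiveModNGaloisRep_two_pow_pos_of Wd fun n ↦ ?_
  exact (Summit.BirchSwinnertonDyer.Rank1Residual.GaloisImage.hasSurjectiveModNGaloisRep_pow_iff_of_model_twist
    W 2 hd hWd n).mpr (forall_hasSurjectiveModNGaloisRep_two_pow_of_pos W hρ n)

/-- **Item 23715 ⟹ BSD₂ of the odd-Tamagawa rank-one twins of a big-image curve.** For `E/ℚ` (model `W`) with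
`ρ̄_{E,2^n}` onto for all `n ≥ 1` (binder O1 of this route's habitat), `d ≠ 0`, and ANY globally minimal `ℚ`-model `Wd`
of `E^{(d)}` that is non-CM, of analytic rank `1`, with ODD Tamagawa product: `BSDp Wd 2`. No `2`-Selmer hypothesis and
no hypothesis on `r_an(E)`, the Tamagawa numbers of `E`, or the parametrisation. [cite: SilvermanAEC2009, X.5 Cor. 5.4] -/
theorem bsdp_two_twin_of_rankOneAtTwoBigImageOddLocal (h : ByReductionTypeAtTwo.RankOneAtTwoBigImageOddLocal)
    (W : WeierstrassCurve ℚ) [W.IsElliptic]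
    (hρ : ∀ n : ℕ, 0 < n → W.HasSurjectiveModNGaloisRep ((2 : ℤ) ^ n)) {d : ℚ} (hd : d ≠ 0)
    (Wd : WeierstrassCurve ℚ) [Wd.IsElliptic] [Wd.IsGloballyMinimal]
    (hWd : ∃ C : VariableChange ℚ, C • W.quadraticTwist d = Wd) (hcmd : ¬ Wd.HasCM)
    (hTd : Odd Wd.tamagawaProduct) (hard : Wd.analyticRank = 1) : BSDp Wd 2 :=
  bsdp_two_of_rankOneAtTwoBigImageOddLocal h Wd hcmd
    (forall_hasSurjectiveModNGaloisRep_two_pow_of_model_twist W hρ hd hWd) hTd hard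

/-- **The route's shape: the Heegner twin `Wd ≅ E^{(d_K)}`.** With `K` a number field (in the route: the imaginary
quadratic Heegner field), `d_K ≠ 0`, so the previous theorem applies to the glue's twin: granted item 23715, the
rank-one input `BSDp Wd 2` that `closes` consumes holds for every minimal twin with ODD Tamagawa product — on that
sub-habitat crux #6 is not needed. [cite: SilvermanAEC2009, X.5 Cor. 5.4] -/
theorem bsdp_two_heegnerTwin_of_rankOneAtTwoBigImageOddLocal
    (h : ByReductionTypeAtTwo.RankOneAtTwoBigImageOddLocal)
    (W : WeierstrassCurve ℚ) [W.IsElliptic]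
    (hρ : ∀ n : ℕ, 0 < n → W.HasSurjectiveModNGaloisRep ((2 : ℤ) ^ n))
    (K : Type) [Field K] [NumberField K]
    (Wd : WeierstrassCurve ℚ) [Wd.IsElliptic] [Wd.IsGloballyMinimal]
    (hWd : ∃ C : VariableChange ℚ, C • W.quadraticTwist (NumberField.discr K : ℚ) = Wd) (hcmd : ¬ Wd.HasCM)
    (hTd : Odd Wd.tamagawaProduct) (hard : Wd.analyticRank = 1) : BSDp Wd 2 :=
  bsdp_two_twin_of_rankOneAtTwoBigImageOddLocal h W hρ
    (by exact_mod_cast NumberField.discr_ne_zero K) Wd hWd hcmd hTd hard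

end Summit.BirchSwinnertonDyer.BirchSwinnertonDyer.Theorems.MinimalTwinBSDTwo

end
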